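import Mathlib
import HarnessLib
import Summits.NavierStokesRegularity.NavierStokesRegularity.Theorems.UnthreadedDoorAntidynamoWallOneInstantRigidMotion

/-!
# Route `UnthreadedDoor` / `ThreadingFlux`, crux `PoloidalLiouville` (stmt-NavierStokesRegularity-1222), antidynamo v2 skeleton (sha16 `4ebf5683127b`),
# WALL `stub_scalarLiouville`: vorticity INDEPENDENT OF ONE DIRECTION on ONE open set at ONE instant (local 2.5-dimensionality) ⇒ irrotational

Support file (seat leafhand-ns-unthreadeddoor-2 g2, cell decomp-ns), `--supports stmt-NavierStokesRegularity-1222 --as helper`; theorems only.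

* ★★ `curl_eq_zero_of_fderiv_curl_dir_eq_zero_on_open` — if at ONE instant `t₁ < 0`, on ONE non-empty open set, the directional derivative `D(curl v(t₁))(x) d`
  of the vorticity of a flow of the wall's class vanishes for ONE `d ≠ 0` (the vorticity is locally a function of two coordinates), then `curl v ≡ 0`:
  in the analytic frame (`CellFlux.unthreadedAnalyticOrIrrotational`) the directional derivative is real-analytic and vanishes identically (identity theorem),
  so `curl v(t₁)` is invariant under the translation by `d`, which kills the flow at one instant (`curl_eq_zero_of_curl_translate_slice`, p819177:
  `x₀ − d` is a second centre of tangency).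

HONEST LABEL: a corollary; nothing here proves `stub_scalarLiouville`, `PoloidalLiouville` (1222), or bears on Navier–Stokes regularity; no summit statement is
proved. [folklore] [cite: KochNadirashviliSereginSverak2009, Thm 5.2 (arXiv:0709.3599 pp. 9–10); LemarieRieusset2016, Thm. 9.12]
-/

noncomputable section

-- the summit and its single sub-problem share the name (CONVENTIONS §1)
set_option linter.dupNamespace false

open scoped Topology InnerProductSpace RealInnerProductSpace ContDiff
open Filter Set Function Metric MeasureTheory
open Literature.Analysis Literature.Analysis.FluidPDE

namespace Summit.NavierStokesRegularity.NavierStokesRegularity.Theorems.PoloidalLiouville.Antidynamo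

open Summit.NavierStokesRegularity.NavierStokesRegularity.Theorems.PoloidalLiouville
  (toroidalPotential exists_norm_curl_le constantOfIrrotational)
open Summit.NavierStokesRegularity.NavierStokesRegularity.Theorems.PoloidalLiouville.NetFlux (E3)

namespace OneInstant

/-- ★★ **VORTICITY INDEPENDENT OF ONE DIRECTION ON ONE OPEN SET AT ONE INSTANT ⇒ IRROTATIONAL.**  Let `v` be a bounded ancient mild solution (`ν = 1`, duality
class) with measurable slices, jointly smooth on `(−∞,0) × ℝ³`, with vorticity tangent to the spheres about `x₀`.  If for ONE `t₁ < 0`, ONE `d ≠ 0` and ONE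
non-empty open set `U`, `D(curl v(t₁))(x) d = 0` for all `x ∈ U`, then `curl v ≡ 0` on `(−∞,0) × ℝ³`.
[cite: KochNadirashviliSereginSverak2009, Thm 5.2 (arXiv:0709.3599 pp. 9–10); LemarieRieusset2016, Thm. 9.12] -/
theorem curl_eq_zero_of_fderiv_curl_dir_eq_zero_on_open
    (v : ℝ → EuclideanSpace ℝ (Fin 3) → EuclideanSpace ℝ (Fin 3)) (x₀ : EuclideanSpace ℝ (Fin 3))
    (hB : Literature.Analysis.FluidPDE.IsBoundedAncientMildSolution 1 v)
    (hm : ∀ t < 0, AEStronglyMeasurable (v t) volume)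
    (hsm : ContDiffOn ℝ (⊤ : ℕ∞) (Function.uncurry v) (Set.Iio 0 ×ˢ Set.univ))
    (hun : ∀ t < 0, ∀ x, ⟪x - x₀, curl (v t) x⟫ = 0)
    (hU : ∃ t₁ < 0, ∃ d : EuclideanSpace ℝ (Fin 3), d ≠ 0 ∧ ∃ U : Set (EuclideanSpace ℝ (Fin 3)), IsOpen U ∧ U.Nonempty ∧
      ∀ x ∈ U, fderiv ℝ (curl (v t₁)) x d = 0) :
    ∀ t < 0, ∀ x, curl (v t) x = 0 := by
  obtain ⟨t₁, ht₁, d, hd, U, hUo, ⟨y₀, hy₀⟩, hUd⟩ := hU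
  obtain ⟨K, hK⟩ := exists_norm_curl_le hB hsm
  obtain ⟨T, -, -, hlink⟩ := toroidalPotential v x₀ K hsm hK hun
  rcases CellFlux.unthreadedAnalyticOrIrrotational v x₀ T hB hm hsm hlink with hA | hZ
  · have hsl : ∀ z : E3, AnalyticAt ℝ (curl (v t₁)) z := fun z => analyticAt_curl_slice hA ht₁ z
    -- the directional derivative is analytic on `ℝ³` and vanishes on `U`, hence everywhere
    have hg : AnalyticOnNhd ℝ (fun x : E3 => fderiv ℝ (curl (v t₁)) x d) univ := fun x _ =>
      ((ContinuousLinearMap.apply ℝ (EuclideanSpace ℝ (Fin 3)) d).analyticAt _).comp (hsl x).fderiv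
    have hev : (fun x : E3 => fderiv ℝ (curl (v t₁)) x d) =ᶠ[𝓝 y₀] 0 := by
      filter_upwards [hUo.mem_nhds hy₀] with z hz
      exact hUd z hz
    have hall : ∀ x, fderiv ℝ (curl (v t₁)) x d = 0 := fun x =>
      hg.eqOn_zero_of_preconnected_of_eventuallyEq_zero isPreconnected_univ (mem_univ y₀) hev (mem_univ x)
    have hdiff : Differentiable ℝ (curl (v t₁)) := fun z => (hsl z).differentiableAt
    -- vanishing directional derivative ⇒ invariance under the translation by `d` (mean value along the lines `x + ℝ d`;
    -- cf. `ScenarioCensus.GeneratorMeter.periodic_of_fderiv_eq_zero`)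
    have htr : ∀ x, curl (v t₁) (x + d) = curl (v t₁) x := fun x => by
      have hl : ∀ s : ℝ, HasFDerivAt (fun s : ℝ => x + s • d) ((ContinuousLinearMap.id ℝ ℝ).smulRight d) s := fun s =>
        ((hasFDerivAt_id s).smul_const d).const_add x
      have hc : ∀ s : ℝ, HasFDerivAt (curl (v t₁) ∘ fun s : ℝ => x + s • d)
          ((fderiv ℝ (curl (v t₁)) (x + s • d)).comp ((ContinuousLinearMap.id ℝ ℝ).smulRight d)) s := fun s =>
        (hdiff (x + s • d)).hasFDerivAt.comp s (hl s)
      have hφd : Differentiable ℝ (curl (v t₁) ∘ fun s : ℝ => x + s • d) := fun s => (hc s).differentiableAt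
      have hφ' : ∀ s, fderiv ℝ (curl (v t₁) ∘ fun s : ℝ => x + s • d) s = 0 := fun s => by
        rw [(hc s).fderiv]
        refine ContinuousLinearMap.ext fun r => ?_
        simp [hall (x + s • d)]
      have key := is_const_of_fderiv_eq_zero hφd hφ' 1 0
      simpa using key
    exact curl_eq_zero_of_curl_translate_slice v x₀ hB hm hsm hun ⟨t₁, ht₁, d, hd, htr⟩
  · exact hZ

/-- ★★ **… HENCE SLICE-WISE CONSTANT.** [cite: KochNadirashviliSereginSverak2009, Thm 5.2 (arXiv:0709.3599 pp. 9–10)] -/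
theorem constant_of_fderiv_curl_dir_eq_zero_on_open
    (v : ℝ → EuclideanSpace ℝ (Fin 3) → EuclideanSpace ℝ (Fin 3)) (x₀ : EuclideanSpace ℝ (Fin 3))
    (hB : Literature.Analysis.FluidPDE.IsBoundedAncientMildSolution 1 v)
    (hm : ∀ t < 0, AEStronglyMeasurable (v t) volume)
    (hsm : ContDiffOn ℝ (⊤ : ℕ∞) (Function.uncurry v) (Set.Iio 0 ×ˢ Set.univ))
    (hun : ∀ t < 0, ∀ x, ⟪x - x₀, curl (v t) x⟫ = 0)
    (hU : ∃ t₁ < 0, ∃ d : EuclideanSpace ℝ (Fin 3), d ≠ 0 ∧ ∃ U : Set (EuclideanSpace ℝ (Fin 3)), IsOpen U ∧ U.Nonempty ∧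
      ∀ x ∈ U, fderiv ℝ (curl (v t₁)) x d = 0) :
    ∀ t < 0, ∃ c : EuclideanSpace ℝ (Fin 3), ∀ x, v t x = c :=
  constantOfIrrotational v hB hsm (curl_eq_zero_of_fderiv_curl_dir_eq_zero_on_open v x₀ hB hm hsm hun hU)

/-- ★★ **THE WALL'S LETTER**: if `curl v = ∇T × (· − x₀)` and at ONE instant, on ONE non-empty open set, the vorticity is independent of ONE direction
(`D(curl v(t₁)) d = 0`, `d ≠ 0`), then `∇T × (x − x₀) ≡ 0`. [cite: KochNadirashviliSereginSverak2009, Thm 5.2 (arXiv:0709.3599 pp. 9–10)] -/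
theorem stubScalarLiouville_of_fderiv_curl_dir_eq_zero_on_open
    (v : ℝ → EuclideanSpace ℝ (Fin 3) → EuclideanSpace ℝ (Fin 3)) (x₀ : EuclideanSpace ℝ (Fin 3))
    (T : ℝ → EuclideanSpace ℝ (Fin 3) → ℝ)
    (hB : Literature.Analysis.FluidPDE.IsBoundedAncientMildSolution 1 v)
    (hm : ∀ t < 0, AEStronglyMeasurable (v t) volume)
    (hsm : ContDiffOn ℝ (⊤ : ℕ∞) (Function.uncurry v) (Set.Iio 0 ×ˢ Set.univ))
    (hrep : ∀ t < 0, ∀ x, Literature.Analysis.FluidPDE.curl (v t) x =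
      Literature.Analysis.FluidPDE.cross (gradient (T t) x) (x - x₀))
    (hU : ∃ t₁ < 0, ∃ d : EuclideanSpace ℝ (Fin 3), d ≠ 0 ∧ ∃ U : Set (EuclideanSpace ℝ (Fin 3)), IsOpen U ∧ U.Nonempty ∧
      ∀ x ∈ U, fderiv ℝ (curl (v t₁)) x d = 0) :
    ∀ t < 0, ∀ x, Literature.Analysis.FluidPDE.cross (gradient (T t) x) (x - x₀) = 0 := by
  have hun : ∀ t < 0, ∀ x, ⟪x - x₀, curl (v t) x⟫ = 0 := fun t ht x => by
    rw [hrep t ht x]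
    simp [cross, crossProduct, PiLp.inner_apply, Fin.sum_univ_three]
    ring
  intro t ht x
  rw [← hrep t ht x]
  exact curl_eq_zero_of_fderiv_curl_dir_eq_zero_on_open v x₀ hB hm hsm hun hU t ht x

end OneInstant

end Summit.NavierStokesRegularity.NavierStokesRegularity.Theorems.PoloidalLiouville.Antidynamo

end
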